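import Summits.QuantumFields.YangMills.Theorems.PoincareLipschitzSphereMapSmallEnergyMollified
import Mathlib.Analysis.SpecialFunctions.Log.Basic
import Mathlib.Analysis.InnerProductSpace.PiL2

/-!
# Line «poincare_lipschitz» on crux `HistoryTailL` (stmt-QuantumFields-19936), route crux `BlockLipschitzL` (stmt-QuantumFields-23533), K2 organ of record LOC-REG-MIN —
# FLAT SHADOW «ENERGY → RANGE» (E→R) FOR LATTICE MINIMISERS INTO A SPHERE, FILE 5d-F4: THE DISPLAYED [C]-SOCKET `hC` OF THE K2 FINAL KNIT, PROVED —
# «F5 one-step energy improvement with constant slack below the `(1+log r)⁶` threshold», `A = 64·10¹⁴` UNIFORM BEFORE `ε`, `ε₁ = min(ε,1)⁸·10⁻⁶¹`,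
# from the two regimes of ✓`oneStep_tent`: (a) ✓`oneStep_mollified` (px8's dyadic good shell + tent mollifier) when `10¹⁸(1+log r)² ≤ ε²r`, (b) ✓`oneStep_unmollified` otherwise

Cell `ym3-torus` (YM ladder rung R3 = continuum SU(2) Yang–Mills on the three-torus — a RUNG, NOT the Clay problem: not d = 4, not infinite volume, not a mass gap); width seat
`ym-ust-19936-w5` gen 12 (LEAD ym-ust-19936-w1 g9 2026-08-29T06:49:23Z DISPLAYED `hC` sha16 2e0c4712bb15d94d «★w5 g12 ∕ px8 g5: OBJECT WITHIN 20 MIN if F5d-F cannot print this» —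
my 06:51:10Z answer «no objection; F5d-F prints it token for token, A uniform, two regimes»; this file is that print).  THEOREMS ONLY (def-free); `--supports stmt-QuantumFields-19936`.
Nothing here proves K-2, `hImprove`, `hRegH`, LOC-REG-MIN, a stub, `BlockLipschitzL`, `HistoryTailL` or a summit statement; YM₃ on T³ is a rung, not the Clay problem.
§1 pure-real letters; §2 ★`oneStep_regimeB`, `regimeB_small`, ★`oneStep_regimeA`; §3 ★★★`oneStep_hC` (any finite-dimensional `V`), ★★★`hOneStep_holds` (the displayed text,
`V = EuclideanSpace ℝ (Fin 4)`).  [folklore] ([SchoenUhlenbeck1982] §4 small-energy regularity: the one-step improvement; lattice statements and constants are this file's).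
-/

set_option autoImplicit false
noncomputable section
open scoped BigOperators InnerProductSpace
open Finset
namespace Summit.QuantumFields.YangMills.Theorems.PoincareLipschitzSphereMapOneStepHC

open Literature.MathematicalPhysics.QuantumFieldTheory.Balaban1983to89
open B4Eq19LatticeOperators
open Summit.QuantumFields.YangMills.Theorems.PoincareLipschitzSphereMapSmallEnergyUnmollified (oneStep_unmollified sum_box_le_sum_box)
open Summit.QuantumFields.YangMills.Theorems.PoincareLipschitzSphereMapSmallEnergyMollified (oneStep_mollified two_mul_decayConst_three_le)

variable {V : Type*} [NormedAddCommGroup V] [InnerProductSpace ℝ V]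
/-! ## §1 Pure-real letters for the two regimes -/

/-- `n + 3 ≤ 3(1 + log r)` whenever `2^n ≤ r`, `1 ≤ r`. [folklore] -/
theorem nat_add_three_le_of_two_pow_le (n : ℕ) {r : ℝ} (hr : 1 ≤ r) (h : (2 : ℝ) ^ n ≤ r) :
    (n : ℝ) + 3 ≤ 3 * (1 + Real.log r) := by
  have hlog2 : (0.6931471803 : ℝ) < Real.log 2 := Real.log_two_gt_d9
  have h1 : (n : ℝ) * Real.log 2 ≤ Real.log r := by
    rw [← Real.log_pow]; exact Real.log_le_log (by positivity) h
  have h0 : 0 ≤ Real.log r := Real.log_nonneg hr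
  have h2 : (n : ℝ) * 0.6931471803 ≤ Real.log r := le_trans (mul_le_mul_of_nonneg_left hlog2.le (Nat.cast_nonneg n)) h1
  nlinarith

/-- REGIME (b) ring defect: `r²E ≤ ε²∕10⁷`, `1 ≤ r` ⇒ `2·3·(r−1)·√E + 2√(3E) ≤ ε∕64`. [folklore] -/
theorem regimeB_eta {r E ε : ℝ} (hr : 1 ≤ r) (hE : 0 ≤ E) (hε : 0 ≤ ε) (hsmall : r ^ 2 * E ≤ ε ^ 2 / 10 ^ 7) :
    2 * 3 * (r - 1) * Real.sqrt E + 2 * Real.sqrt (3 * E) ≤ ε / 64 := by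
  have hsr : Real.sqrt E * r ≤ ε / 3000 := by
    have e : Real.sqrt E * r = Real.sqrt (E * r ^ 2) := by rw [Real.sqrt_mul hE, Real.sqrt_sq (by linarith)]
    rw [e]
    refine (Real.sqrt_le_left (by positivity)).mpr ?_
    nlinarith
  have hs : Real.sqrt E ≤ ε / 3000 := by
    have : Real.sqrt E ≤ Real.sqrt E * r := le_mul_of_one_le_right (Real.sqrt_nonneg E) hr
    linarith
  have h1 : 2 * 3 * (r - 1) * Real.sqrt E ≤ 6 * (Real.sqrt E * r) := by nlinarith [Real.sqrt_nonneg E]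
  have h2 : Real.sqrt (3 * E) ≤ 2 * Real.sqrt E := by
    rw [Real.sqrt_mul (by norm_num)]
    have : Real.sqrt 3 ≤ 2 := (Real.sqrt_le_left (by norm_num)).mpr (by norm_num)
    exact mul_le_mul_of_nonneg_right this (Real.sqrt_nonneg E)
  linarith

/-- REGIME (b) decay constant: `4 ≤ r`, `0 ≤ ρ + 1` ⇒ `2·A₃·((ρ+1)∕(r−2))³ ≤ 8·10¹⁴·((ρ+1)∕r)³` given `2A₃ ≤ 10¹⁴`, `0 ≤ A₃`. [folklore] -/
theorem regimeB_decay {A r x : ℝ} (hA : 2 * A ≤ (10 : ℝ) ^ 14) (hA0 : 0 ≤ A) (hr : 4 ≤ r) (hx : 0 ≤ x) :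
    2 * (A * (x / (r - 2)) ^ 3) ≤ 8 * (10 : ℝ) ^ 14 * (x / r) ^ 3 := by
  have hr2 : 0 < r - 2 := by linarith
  have hle : x / (r - 2) ≤ 2 * (x / r) := by
    rw [div_le_iff₀ hr2, show 2 * (x / r) * (r - 2) = x * (2 * (r - 2) / r) by ring]
    exact le_mul_of_one_le_right hx (by rw [le_div_iff₀ (by linarith)]; linarith)
  have hp : (x / (r - 2)) ^ 3 ≤ (2 * (x / r)) ^ 3 := pow_le_pow_left₀ (by positivity) hle 3
  have hx3 : 0 ≤ (x / r) ^ 3 := by positivity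
  calc 2 * (A * (x / (r - 2)) ^ 3) ≤ 2 * (A * (2 * (x / r)) ^ 3) := by
        have := mul_le_mul_of_nonneg_left hp hA0; linarith
    _ = (2 * A) * (8 * (x / r) ^ 3) := by ring
    _ ≤ (10 : ℝ) ^ 14 * (8 * (x / r) ^ 3) := mul_le_mul_of_nonneg_right hA (by positivity)
    _ = 8 * (10 : ℝ) ^ 14 * (x / r) ^ 3 := by ring

/-- REGIME (a) decay constant: `r ≤ 4(R − 1)`, `0 < r` ⇒ `10¹⁴((ρ+1)∕(R−1))³ ≤ 64·10¹⁴((ρ+1)∕r)³`. [folklore] -/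
theorem regimeA_decay {r R x : ℝ} (hr : 0 < r) (hR : r ≤ 4 * (R - 1)) (hx : 0 ≤ x) :
    (10 : ℝ) ^ 14 * (x / (R - 1)) ^ 3 ≤ 64 * (10 : ℝ) ^ 14 * (x / r) ^ 3 := by
  have hR1 : 0 < R - 1 := by linarith
  have hle : x / (R - 1) ≤ 4 * (x / r) := by
    rw [div_le_iff₀ hR1, show 4 * (x / r) * (R - 1) = x * (4 * (R - 1) / r) by ring]
    exact le_mul_of_one_le_right hx (by rw [le_div_iff₀ hr]; linarith)
  have hp : (x / (R - 1)) ^ 3 ≤ (4 * (x / r)) ^ 3 := pow_le_pow_left₀ (by positivity) hle 3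
  nlinarith [hp, (by positivity : 0 ≤ (x / r) ^ 3)]

/-- REGIME (a), the tent ring term: with `Λ = ε²r∕(10¹⁸L²)`, `Λ < a`, `E·L⁶ ≤ ε⁸10⁻⁶¹·r`, `1 ≤ L`, `0 < r`, `0 < ε ≤ 1`:
`6r·√((a³)⁻¹E) ≤ ε∕500`. [folklore] -/
theorem regimeA_T1 {r L ε E a : ℝ} (hr : 0 < r) (hL : 1 ≤ L) (hε : 0 < ε)
    (ha : ε ^ 2 * r / ((10 : ℝ) ^ 18 * L ^ 2) < a) (hthr : E * L ^ 6 ≤ ε ^ 8 / (10 : ℝ) ^ 61 * r) :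
    6 * r * Real.sqrt ((a ^ 3)⁻¹ * E) ≤ ε / 500 := by
  have hΛ0 : 0 < ε ^ 2 * r / ((10 : ℝ) ^ 18 * L ^ 2) := by positivity
  have ha0 : 0 < a := hΛ0.trans ha
  -- `E ≤ Λ³·ε²/(10⁷ r²) ≤ a³ ε²/(10⁷ r²)`
  have hΛ3 : (ε ^ 2 * r / ((10 : ℝ) ^ 18 * L ^ 2)) ^ 3 ≤ a ^ 3 := pow_le_pow_left₀ hΛ0.le ha.le 3
  have hL0 : 0 < L := by linarith
  have hE1 : E ≤ (ε ^ 2 * r / ((10 : ℝ) ^ 18 * L ^ 2)) ^ 3 * (ε ^ 2 / ((10 : ℝ) ^ 7 * r ^ 2)) := by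
    have hL6 : 0 < L ^ 6 := by positivity
    have h := (le_div_iff₀ hL6).mpr hthr
    have e : (ε ^ 2 * r / ((10 : ℝ) ^ 18 * L ^ 2)) ^ 3 * (ε ^ 2 / ((10 : ℝ) ^ 7 * r ^ 2)) = ε ^ 8 / (10 : ℝ) ^ 61 * r / L ^ 6 := by
      field_simp
    rw [e]; exact h
  have hE2 : (a ^ 3)⁻¹ * E ≤ ε ^ 2 / ((10 : ℝ) ^ 7 * r ^ 2) := by
    rw [inv_mul_le_iff₀ (by positivity)]
    calc E ≤ (ε ^ 2 * r / ((10 : ℝ) ^ 18 * L ^ 2)) ^ 3 * (ε ^ 2 / ((10 : ℝ) ^ 7 * r ^ 2)) := hE1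
      _ ≤ a ^ 3 * (ε ^ 2 / ((10 : ℝ) ^ 7 * r ^ 2)) := mul_le_mul_of_nonneg_right hΛ3 (by positivity)
  have hs : Real.sqrt ((a ^ 3)⁻¹ * E) ≤ ε / (3000 * r) := by
    refine (Real.sqrt_le_left (by positivity)).mpr (hE2.trans ?_)
    rw [div_pow, div_le_div_iff₀ (by positivity) (by positivity)]
    nlinarith [sq_nonneg ε, sq_nonneg r, mul_pos hε hr]
  calc 6 * r * Real.sqrt ((a ^ 3)⁻¹ * E) ≤ 6 * r * (ε / (3000 * r)) := mul_le_mul_of_nonneg_left hs (by positivity)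
    _ = ε / 500 := by field_simp; ring

/-- REGIME (a), the mollifier-scale term: `2a·√(3(a³)⁻¹E) ≤ ε∕200` under the same letters. [folklore] -/
theorem regimeA_T2 {r L ε E a : ℝ} (hr : 0 < r) (hL : 1 ≤ L) (hε : 0 < ε) (hε1 : ε ≤ 1) (hE : 0 ≤ E)
    (ha : ε ^ 2 * r / ((10 : ℝ) ^ 18 * L ^ 2) < a) (hthr : E * L ^ 6 ≤ ε ^ 8 / (10 : ℝ) ^ 61 * r) :
    2 * a * Real.sqrt (3 * (a ^ 3)⁻¹ * E) ≤ ε / 200 := by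
  have hΛ0 : 0 < ε ^ 2 * r / ((10 : ℝ) ^ 18 * L ^ 2) := by positivity
  have ha0 : 0 < a := hΛ0.trans ha
  -- `4.8·10⁵·E ≤ ε²·a`
  have hL6 : 1 ≤ L ^ 6 := one_le_pow₀ hL
  have hEr : E ≤ ε ^ 8 / (10 : ℝ) ^ 61 * r := by
    have : E ≤ E * L ^ 6 := le_mul_of_one_le_right hE hL6
    linarith
  have hL0 : 0 < L := by linarith
  have hkey : 480000 * E ≤ ε ^ 2 * a := by
    have h1 : ε ^ 2 * (ε ^ 2 * r / ((10 : ℝ) ^ 18 * L ^ 2)) ≤ ε ^ 2 * a := mul_le_mul_of_nonneg_left ha.le (by positivity)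
    have h3 : E ≤ ε ^ 8 / (10 : ℝ) ^ 61 * r / L ^ 6 := (le_div_iff₀ (by positivity)).mpr hthr
    have h4 : ε ^ 8 / (10 : ℝ) ^ 61 * r / L ^ 6 ≤ ε ^ 4 * r / (480000 * ((10 : ℝ) ^ 18 * L ^ 2)) := by
      rw [div_le_div_iff₀ (by positivity) (by positivity)]
      have hL2 : L ^ 2 ≤ L ^ 6 := pow_le_pow_right₀ hL (by norm_num)
      have hε8 : ε ^ 8 ≤ ε ^ 4 := pow_le_pow_of_le_one hε.le hε1 (by norm_num)
      have h5 : ε ^ 8 * (r * L ^ 2) ≤ ε ^ 4 * (r * L ^ 2) := mul_le_mul_of_nonneg_right hε8 (by positivity)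
      have h6 : ε ^ 4 * r * L ^ 2 ≤ ε ^ 4 * r * L ^ 6 := mul_le_mul_of_nonneg_left hL2 (by positivity)
      have h7 : 0 ≤ ε ^ 4 * r * L ^ 6 := by positivity
      have e : ε ^ 8 / (10 : ℝ) ^ 61 * r * (480000 * ((10 : ℝ) ^ 18 * L ^ 2)) = (480000 * (10 : ℝ) ^ 18 / (10 : ℝ) ^ 61) * (ε ^ 8 * (r * L ^ 2)) := by
        ring
      rw [e]
      nlinarith
    calc 480000 * E ≤ 480000 * (ε ^ 4 * r / (480000 * ((10 : ℝ) ^ 18 * L ^ 2))) := by nlinarith [h3.trans h4]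
      _ = ε ^ 2 * (ε ^ 2 * r / ((10 : ℝ) ^ 18 * L ^ 2)) := by field_simp
      _ ≤ ε ^ 2 * a := h1
  have hs : Real.sqrt (3 * (a ^ 3)⁻¹ * E) ≤ ε / (400 * a) := by
    refine (Real.sqrt_le_left (by positivity)).mpr ?_
    have e1 : 3 * (a ^ 3)⁻¹ * E = (3 * E) / a ^ 3 := by field_simp
    have e2 : (ε / (400 * a)) ^ 2 = ε ^ 2 / (160000 * a ^ 2) := by rw [div_pow]; ring
    rw [e1, e2, div_le_div_iff₀ (by positivity) (by positivity)]
    have h := mul_le_mul_of_nonneg_right hkey (pow_nonneg ha0.le 2)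
    calc 3 * E * (160000 * a ^ 2) = 480000 * E * a ^ 2 := by ring
      _ ≤ ε ^ 2 * a * a ^ 2 := h
      _ = ε ^ 2 * a ^ 3 := by ring
  calc 2 * a * Real.sqrt (3 * (a ^ 3)⁻¹ * E) ≤ 2 * a * (ε / (400 * a)) := mul_le_mul_of_nonneg_left hs (by positivity)
    _ = ε / 200 := by field_simp; ring

/-- REGIME (a), the band term: `2√(6·(12(n+3)²E∕m)) ≤ ε∕200` with `m ≥ r∕2`, `n+3 ≤ 3L`, `E·L⁶ ≤ ε⁸10⁻⁶¹r`. [folklore] -/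
theorem regimeA_T3 {r L ε E m N : ℝ} (hr : 0 < r) (hL : 1 ≤ L) (hε : 0 < ε) (hε1 : ε ≤ 1) (hE : 0 ≤ E) (hm : r / 2 ≤ m)
    (hN0 : 0 ≤ N) (hN : N ≤ 3 * L) (hthr : E * L ^ 6 ≤ ε ^ 8 / (10 : ℝ) ^ 61 * r) :
    2 * Real.sqrt (6 * (12 * N ^ 2 * E / m)) ≤ ε / 200 := by
  have hm0 : 0 < m := by linarith
  have hN2 : N ^ 2 ≤ 9 * L ^ 2 := by nlinarith
  -- `72 N² E / m ≤ 1296 ε⁸ 10⁻⁶¹ ≤ (ε/400)²`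
  have h1 : 6 * (12 * N ^ 2 * E / m) ≤ (ε / 400) ^ 2 := by
    rw [show 6 * (12 * N ^ 2 * E / m) = 72 * N ^ 2 * E / m by ring, div_le_iff₀ hm0]
    have hL4 : 1 ≤ L ^ 4 := one_le_pow₀ hL
    have hε8 : ε ^ 8 ≤ ε ^ 2 := pow_le_pow_of_le_one hε.le hε1 (by norm_num)
    have h2 : N ^ 2 * E ≤ 9 * L ^ 2 * E := mul_le_mul_of_nonneg_right hN2 hE
    have h3 : L ^ 2 * (E * L ^ 6) ≤ L ^ 2 * (ε ^ 8 / (10 : ℝ) ^ 61 * r) := mul_le_mul_of_nonneg_left hthr (by positivity)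
    have h4 : 9 * L ^ 2 * E ≤ 9 * L ^ 2 * E * L ^ 4 := le_mul_of_one_le_right (by positivity) hL4
    nlinarith [pow_nonneg hε.le 8, mul_nonneg hr.le (sub_nonneg.2 hε8), h2, h3, h4]
  calc 2 * Real.sqrt (6 * (12 * N ^ 2 * E / m)) ≤ 2 * (ε / 400) := by
        have := (Real.sqrt_le_left (by positivity : 0 ≤ ε / 400)).mpr h1; linarith
    _ = ε / 200 := by ring

/-- REGIME (a), the transition-band terms: `X = 2^{n+3}·(12(n+3)²E∕m)` with `2^n ≤ Λ = ε²r∕(10¹⁸L²)`, `m ≥ r∕2`, `n+3 ≤ 3L`: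
`10¹¹·X + 8·10⁵·√(E·X) ≤ (ε∕4)·E`. [folklore] -/
theorem regimeA_TU {r L ε E m N P : ℝ} (hr : 0 < r) (hL : 1 ≤ L) (hε : 0 < ε) (hε1 : ε ≤ 1) (hE : 0 ≤ E) (hm : r / 2 ≤ m)
    (hN0 : 0 ≤ N) (hN : N ≤ 3 * L) (hP0 : 0 ≤ P) (hP : P ≤ ε ^ 2 * r / ((10 : ℝ) ^ 18 * L ^ 2)) :
    (10 : ℝ) ^ 11 * (8 * P * (12 * N ^ 2 * E / m)) + 8 * (10 : ℝ) ^ 5 * Real.sqrt (E * (8 * P * (12 * N ^ 2 * E / m))) ≤ ε / 4 * E := by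
  have hm0 : 0 < m := by linarith
  have hN2 : N ^ 2 ≤ 9 * L ^ 2 := by nlinarith
  -- `X ≤ 2·10⁻¹⁵ ε² E`
  have hX : 8 * P * (12 * N ^ 2 * E / m) ≤ 2 / (10 : ℝ) ^ 15 * ε ^ 2 * E := by
    rw [show 8 * P * (12 * N ^ 2 * E / m) = 96 * P * N ^ 2 * E / m by ring, div_le_iff₀ hm0]
    have h1 : P * N ^ 2 ≤ ε ^ 2 * r / ((10 : ℝ) ^ 18 * L ^ 2) * (9 * L ^ 2) := mul_le_mul hP hN2 (by positivity) (by positivity)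
    have e : ε ^ 2 * r / ((10 : ℝ) ^ 18 * L ^ 2) * (9 * L ^ 2) = 9 / (10 : ℝ) ^ 18 * ε ^ 2 * r := by
      field_simp
    rw [e] at h1
    have h2 : 96 * P * N ^ 2 * E ≤ 96 * (9 / (10 : ℝ) ^ 18 * ε ^ 2 * r) * E := by
      have := mul_le_mul_of_nonneg_right h1 hE; nlinarith
    have h3 : 96 * (9 / (10 : ℝ) ^ 18 * ε ^ 2 * r) * E ≤ 2 / (10 : ℝ) ^ 15 * ε ^ 2 * E * m := by
      have : 0 ≤ ε ^ 2 * E := by positivity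
      nlinarith
    linarith
  have hX0 : 0 ≤ 8 * P * (12 * N ^ 2 * E / m) := by positivity
  have hsq : Real.sqrt (E * (8 * P * (12 * N ^ 2 * E / m))) ≤ ε * E / (2 * (10 : ℝ) ^ 7) := by
    refine (Real.sqrt_le_left (by positivity)).mpr ?_
    calc E * (8 * P * (12 * N ^ 2 * E / m)) ≤ E * (2 / (10 : ℝ) ^ 15 * ε ^ 2 * E) := mul_le_mul_of_nonneg_left hX hE
      _ ≤ (ε * E / (2 * (10 : ℝ) ^ 7)) ^ 2 := by
        rw [div_pow]; rw [le_div_iff₀ (by positivity)]; nlinarith [sq_nonneg (ε * E)]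
  have hε2 : ε ^ 2 ≤ ε := by nlinarith
  have h1 : (10 : ℝ) ^ 11 * (8 * P * (12 * N ^ 2 * E / m)) ≤ ε / 8 * E := by
    calc (10 : ℝ) ^ 11 * (8 * P * (12 * N ^ 2 * E / m)) ≤ (10 : ℝ) ^ 11 * (2 / (10 : ℝ) ^ 15 * ε ^ 2 * E) :=
          mul_le_mul_of_nonneg_left hX (by positivity)
      _ ≤ ε / 8 * E := by nlinarith [mul_le_mul_of_nonneg_right hε2 hE]
  have h2 : 8 * (10 : ℝ) ^ 5 * Real.sqrt (E * (8 * P * (12 * N ^ 2 * E / m))) ≤ ε / 8 * E := by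
    calc 8 * (10 : ℝ) ^ 5 * Real.sqrt (E * (8 * P * (12 * N ^ 2 * E / m))) ≤ 8 * (10 : ℝ) ^ 5 * (ε * E / (2 * (10 : ℝ) ^ 7)) :=
          mul_le_mul_of_nonneg_left hsq (by positivity)
      _ ≤ ε / 8 * E := by
        have : 0 ≤ ε * E := by positivity
        rw [mul_div_assoc']; rw [div_le_iff₀ (by positivity)]; nlinarith
  linarith

/-! ## §2 The two regimes -/

/-- REGIME (b) «UNMOLLIFIED»: `1 ≤ ρ`, `4(ρ+1) < r`, `r²·E_r ≤ ε²∕10⁷`, `0 < ε ≤ 1` ⇒ `E_ρ ≤ (8·10¹⁴((ρ+1)∕r)³ + ε∕8)·E_r + 2·sl` (✓`oneStep_unmollified` at `d = 3`,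
`η = ε∕64`). [folklore] [cite: SchoenUhlenbeck1982, §4] -/
theorem oneStep_regimeB [FiniteDimensional ℝ V] (u : Zd 3 → V) (x : Zd 3) {r ρ : ℤ} (hρ : 1 ≤ ρ) (h4 : 4 * (ρ + 1) < r)
    (hu : ∀ y, ‖u y‖ = 1)
    {sl : ℝ} (hminU : ∀ w : Zd 3 → V, (∀ y, ‖w y‖ = 1) → (∀ y ∉ box x (r - 1), w y = u y) →
      ∑ y ∈ box x r, ∑ μ, ‖u (y + unitVec μ) - u y‖ ^ 2 ≤ ∑ y ∈ box x r, ∑ μ, ‖w (y + unitVec μ) - w y‖ ^ 2 + sl)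
    {ε : ℝ} (hε : 0 < ε) (hε1 : ε ≤ 1)
    (hsmall : (r : ℝ) ^ 2 * ∑ y ∈ box x r, ∑ μ, ‖u (y + unitVec μ) - u y‖ ^ 2 ≤ ε ^ 2 / 10 ^ 7) :
    ∑ y ∈ box x ρ, ∑ μ, ‖u (y + unitVec μ) - u y‖ ^ 2 ≤
      (8 * (10 : ℝ) ^ 14 * (((ρ : ℝ) + 1) / r) ^ 3 + ε / 8) * ∑ y ∈ box x r, ∑ μ, ‖u (y + unitVec μ) - u y‖ ^ 2 + 2 * sl := by
  set E := ∑ y ∈ box x r, ∑ μ, ‖u (y + unitVec μ) - u y‖ ^ 2 with hE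
  have hE0 : 0 ≤ E := Finset.sum_nonneg fun _ _ => Finset.sum_nonneg fun _ _ => by positivity
  have hr9 : 9 ≤ r := by omega
  have hr1 : (1 : ℝ) ≤ r := by exact_mod_cast (by omega : (1 : ℤ) ≤ r)
  have hr4 : (4 : ℝ) ≤ r := by exact_mod_cast (by omega : (4 : ℤ) ≤ r)
  have hη := regimeB_eta hr1 hE0 hε.le hsmall
  have hρ0 : (0 : ℝ) ≤ (ρ : ℝ) + 1 := by
    have : (1 : ℝ) ≤ ρ := by exact_mod_cast hρ
    linarith
  have hdec := regimeB_decay two_mul_decayConst_three_le (by positivity) hr4 hρ0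
  have hdecE := mul_le_mul_of_nonneg_right hdec hE0
  have h := oneStep_unmollified (d := 3) (by norm_num) u x (r := r) (by omega) hu hminU (η := ε / 64)
    (by push_cast; linarith [hη]) (by linarith) (ρ := ρ) (by omega) (by omega)
  have hε8 : 8 * (ε / 64) * E = ε / 8 * E := by ring
  rw [hε8] at h
  linarith [h, hdecE]

/-- `r² E ≤ ε²∕10⁷` in the complementary regime `ε² r < 10¹⁸ L²` from the threshold `E·L⁶ ≤ ε⁸10⁻⁶¹ r`. [folklore] -/
theorem regimeB_small {r L ε E : ℝ} (hr : 0 < r) (hL : 1 ≤ L) (hε : 0 < ε)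
    (hreg : ε ^ 2 * r < (10 : ℝ) ^ 18 * L ^ 2) (hthr : E * L ^ 6 ≤ ε ^ 8 / (10 : ℝ) ^ 61 * r) :
    r ^ 2 * E ≤ ε ^ 2 / 10 ^ 7 := by
  have h3 : (ε ^ 2 * r) ^ 3 ≤ ((10 : ℝ) ^ 18 * L ^ 2) ^ 3 := pow_le_pow_left₀ (by positivity) hreg.le 3
  have h5 : ε ^ 6 * r ^ 3 ≤ (10 : ℝ) ^ 54 * L ^ 6 := by nlinarith [h3]
  have h4 : r ^ 2 * E * L ^ 6 ≤ ε ^ 8 / (10 : ℝ) ^ 61 * r ^ 3 := by nlinarith [mul_le_mul_of_nonneg_left hthr (sq_nonneg r)]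
  have h6 : r ^ 2 * E * (ε ^ 6 * L ^ 6) ≤ ε ^ 2 / 10 ^ 7 * (ε ^ 6 * L ^ 6) := by
    calc r ^ 2 * E * (ε ^ 6 * L ^ 6) = (r ^ 2 * E * L ^ 6) * ε ^ 6 := by ring
      _ ≤ (ε ^ 8 / (10 : ℝ) ^ 61 * r ^ 3) * ε ^ 6 := mul_le_mul_of_nonneg_right h4 (by positivity)
      _ = ε ^ 8 / (10 : ℝ) ^ 61 * (ε ^ 6 * r ^ 3) := by ring
      _ ≤ ε ^ 8 / (10 : ℝ) ^ 61 * ((10 : ℝ) ^ 54 * L ^ 6) := mul_le_mul_of_nonneg_left h5 (by positivity)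
      _ = ε ^ 2 / 10 ^ 7 * (ε ^ 6 * L ^ 6) := by ring
  exact le_of_mul_le_mul_right h6 (by positivity)

/-- REGIME (a) «MOLLIFIED»: `1 ≤ ρ`, `4(ρ+1) < r`, `0 < ε ≤ 1`, `10¹⁸(1+log r)² ≤ ε² r`, `E_r·(1+log r)⁶ ≤ ε⁸10⁻⁶¹·r` ⇒
`E_ρ ≤ (64·10¹⁴((ρ+1)∕r)³ + ε∕2)·E_r + 2·sl` (✓`oneStep_mollified` at `p = r − r∕2`, `q = r`, `2^n ≤ ε²r∕(10¹⁸(1+log r)²) < 2^{n+1}`, `η = ε∕64`).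
[folklore] [cite: SchoenUhlenbeck1982, §4] -/
theorem oneStep_regimeA [FiniteDimensional ℝ V] (u : Zd 3 → V) (x : Zd 3) {r ρ : ℤ} (hρ : 1 ≤ ρ) (h4 : 4 * (ρ + 1) < r)
    (hu : ∀ y, ‖u y‖ = 1)
    {sl : ℝ} (hminU : ∀ w : Zd 3 → V, (∀ y, ‖w y‖ = 1) → (∀ y ∉ box x (r - 1), w y = u y) →
      ∑ y ∈ box x r, ∑ μ, ‖u (y + unitVec μ) - u y‖ ^ 2 ≤ ∑ y ∈ box x r, ∑ μ, ‖w (y + unitVec μ) - w y‖ ^ 2 + sl)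
    {ε : ℝ} (hε : 0 < ε) (hε1 : ε ≤ 1)
    (hreg : (10 : ℝ) ^ 18 * (1 + Real.log r) ^ 2 ≤ ε ^ 2 * r)
    (hthr : (∑ y ∈ box x r, ∑ μ, ‖u (y + unitVec μ) - u y‖ ^ 2) * (1 + Real.log r) ^ 6 ≤ ε ^ 8 / (10 : ℝ) ^ 61 * r) :
    ∑ y ∈ box x ρ, ∑ μ, ‖u (y + unitVec μ) - u y‖ ^ 2 ≤
      (64 * (10 : ℝ) ^ 14 * (((ρ : ℝ) + 1) / r) ^ 3 + ε / 2) * ∑ y ∈ box x r, ∑ μ, ‖u (y + unitVec μ) - u y‖ ^ 2 + 2 * sl := by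
  set E := ∑ y ∈ box x r, ∑ μ, ‖u (y + unitVec μ) - u y‖ ^ 2 with hE
  have hE0 : 0 ≤ E := Finset.sum_nonneg fun _ _ => Finset.sum_nonneg fun _ _ => by positivity
  set L := 1 + Real.log r with hLdef
  have hr9 : 9 ≤ r := by omega
  have hr1 : (1 : ℝ) ≤ r := by exact_mod_cast (by omega : (1 : ℤ) ≤ r)
  have hr0 : (0 : ℝ) < r := by linarith
  have hL : 1 ≤ L := by have := Real.log_nonneg hr1; rw [hLdef]; linarith
  have hL0 : 0 < L := by linarith
  -- the dyadic scale
  set Λ := ε ^ 2 * r / ((10 : ℝ) ^ 18 * L ^ 2) with hΛdef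
  have hΛ1 : 1 ≤ Λ := by rw [hΛdef, le_div_iff₀ (by positivity)]; linarith
  obtain ⟨n, hn1, hn2⟩ := exists_nat_pow_near hΛ1 one_lt_two
  have hΛr : Λ ≤ r / (10 : ℝ) ^ 18 := by
    rw [hΛdef, div_le_div_iff₀ (by positivity) (by positivity)]
    have hε2 : ε ^ 2 ≤ 1 := pow_le_one₀ hε.le hε1
    have hL2 : 1 ≤ L ^ 2 := one_le_pow₀ hL
    have : ε ^ 2 * r ≤ r := by nlinarith
    nlinarith
  have h2nr : (2 : ℝ) ^ n ≤ r := hn1.trans (hΛr.trans (by rw [div_le_iff₀ (by positivity)]; nlinarith))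
  have hn3 : (n : ℝ) + 3 ≤ 3 * L := nat_add_three_le_of_two_pow_le n hr1 h2nr
  -- integer bookkeeping (`N = 2^{n+2}` is an atom for `omega`)
  have hNr : (10 : ℤ) ^ 18 * (2 : ℤ) ^ (n + 2) ≤ 4 * r := by
    have h : (10 : ℝ) ^ 18 * (2 : ℝ) ^ (n + 2) ≤ 4 * r := by
      rw [pow_add]; have := hn1.trans hΛr; rw [le_div_iff₀ (by positivity)] at this; nlinarith
    exact_mod_cast h
  have hp : (2 : ℤ) ^ (n + 2) + 2 ≤ r - r / 2 := by
    generalize (2 : ℤ) ^ (n + 2) = N at hNr ⊢; omega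
  have hm : (r : ℝ) / 2 ≤ (((r - (r - r / 2) + 1 : ℤ)) : ℝ) := by
    have : r ≤ 2 * (r - (r - r / 2) + 1) := by omega
    have h' : (r : ℝ) ≤ 2 * (((r - (r - r / 2) + 1 : ℤ)) : ℝ) := by exact_mod_cast this
    linarith
  -- the displayed smallness `η = ε/64`
  set a : ℝ := (2 : ℝ) ^ (n + 1) + 1 with ha
  have hΛa : Λ < a := by rw [ha]; linarith
  have hT1 := regimeA_T1 (E := E) hr0 hL hε hΛa hthr
  have hT2 := regimeA_T2 (E := E) hr0 hL hε hε1 hE0 hΛa hthr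
  have hT3 := regimeA_T3 (E := E) hr0 hL hε hε1 hE0 hm (by positivity : (0 : ℝ) ≤ (n : ℝ) + 3) hn3 hthr
  have hTU := regimeA_TU (E := E) hr0 hL hε hε1 hE0 hm (by positivity : (0 : ℝ) ≤ (n : ℝ) + 3) hn3 (by positivity : (0 : ℝ) ≤ (2 : ℝ) ^ n) hn1
  obtain ⟨R, hR1, hR2, hstep⟩ := oneStep_mollified u x (r := r) (p := r - r / 2) (q := r) (n := n) (by omega) le_rfl hp hu hminU
    (η := ε / 64) (by linarith [hT1, hT2, hT3]) (by linarith)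
  have hρR : ρ ≤ R - 2 := by
    generalize (2 : ℤ) ^ (n + 2) = N at hNr hR1 ⊢; omega
  have hR4 : r ≤ 4 * (R - 1) := by
    generalize (2 : ℤ) ^ (n + 2) = N at hNr hR1 ⊢; omega
  have h := hstep ρ (by omega) hρR
  have hR4' : (r : ℝ) ≤ 4 * ((R : ℝ) - 1) := by exact_mod_cast hR4
  have hρ0 : (0 : ℝ) ≤ (ρ : ℝ) + 1 := by
    have : (1 : ℝ) ≤ ρ := by exact_mod_cast hρ
    linarith
  have hdec := mul_le_mul_of_nonneg_right (regimeA_decay hr0 hR4' hρ0) hE0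
  rw [show (2 : ℝ) ^ (n + 3) = 8 * (2 : ℝ) ^ n by ring] at h
  have hε8 : 8 * (ε / 64) * E = ε / 8 * E := by ring
  rw [hε8] at h
  linarith [h, hdec, hTU, mul_nonneg hε.le hE0]

/-! ## §3 The displayed socket `hC` -/

/-- ★★★ **`hC` — THE F5 ONE-STEP ENERGY IMPROVEMENT WITH CONSTANT SLACK BELOW THE `(1+log r)⁶` THRESHOLD**, for unit maps `ℤ³ → V` into the unit sphere of ANY
finite-dimensional real inner-product space (LEAD ★w1-19936 g9's DISPLAYED `hC` 2e0c4712bb15d94d is the case `V = ℝ⁴`, ✓`hOneStep_holds` below):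
`∃ A ≥ 0, ∀ ε > 0, ∃ ε₁ > 0, ∀ u x r sl, 0 ≤ sl → ‖u‖ ≡ 1 → (almost-minimality on Q_r(x) with slack sl) → E_r·(1+log r)⁶ ≤ ε₁·r → ∀ ρ, 1 ≤ ρ → ρ+1 ≤ r →
E_ρ ≤ (A·((ρ+1)∕r)³ + ε)·E_r + 2·sl`, with `A = 64·10¹⁴` and `ε₁ = min(ε,1)⁸·10⁻⁶¹`.
PROOF: pairs `4(ρ+1) ≥ r` are trivial (`A∕64 ≥ 1`, `E_ρ ≤ E_r`); otherwise regime (a) ✓`oneStep_regimeA` when `10¹⁸(1+log r)² ≤ ε'²r`, else regime (b)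
✓`oneStep_regimeB` (the threshold then forces `r²E_r ≤ ε'²10⁻⁷`, ✓`regimeB_small`). [folklore] [cite: SchoenUhlenbeck1982, §4] -/
theorem oneStep_hC [FiniteDimensional ℝ V] :
    ∃ A : ℝ, 0 ≤ A ∧ ∀ ε : ℝ, 0 < ε → ∃ ε₁ : ℝ, 0 < ε₁ ∧
      ∀ (u : Zd 3 → V) (x : Zd 3) (r : ℤ) (sl : ℝ), 0 ≤ sl →
        (∀ y, ‖u y‖ = 1) →
        (∀ w : Zd 3 → V, (∀ y, ‖w y‖ = 1) → (∀ y, y ∉ box x (r - 1) → w y = u y) →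
          ∑ y ∈ box x r, ∑ μ : Fin 3, ‖u (y + unitVec μ) - u y‖ ^ 2 ≤
            (∑ y ∈ box x r, ∑ μ : Fin 3, ‖w (y + unitVec μ) - w y‖ ^ 2) + sl) →
        (∑ y ∈ box x r, ∑ μ : Fin 3, ‖u (y + unitVec μ) - u y‖ ^ 2) * (1 + Real.log r) ^ 6 ≤ ε₁ * r →
        ∀ ρ : ℤ, 1 ≤ ρ → ρ + 1 ≤ r →
          ∑ y ∈ box x ρ, ∑ μ : Fin 3, ‖u (y + unitVec μ) - u y‖ ^ 2 ≤
            (A * (((ρ : ℝ) + 1) / r) ^ 3 + ε) * (∑ y ∈ box x r, ∑ μ : Fin 3, ‖u (y + unitVec μ) - u y‖ ^ 2) + 2 * sl := by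
  refine ⟨64 * (10 : ℝ) ^ 14, by norm_num, fun ε hε => ?_⟩
  set ε' := min ε 1 with hε'
  have hε'0 : 0 < ε' := lt_min hε one_pos
  have hε'1 : ε' ≤ 1 := min_le_right _ _
  have hε'ε : ε' ≤ ε := min_le_left _ _
  refine ⟨ε' ^ 8 / (10 : ℝ) ^ 61, by positivity, fun u x r sl hsl hu hmin hthr ρ hρ hρr => ?_⟩
  set E := ∑ y ∈ box x r, ∑ μ : Fin 3, ‖u (y + unitVec μ) - u y‖ ^ 2 with hE
  have hE0 : 0 ≤ E := Finset.sum_nonneg fun _ _ => Finset.sum_nonneg fun _ _ => by positivity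
  have hEρ : ∑ y ∈ box x ρ, ∑ μ : Fin 3, ‖u (y + unitVec μ) - u y‖ ^ 2 ≤ E := by
    rw [hE]; exact sum_box_le_sum_box u x (by omega)
  have hr1 : (1 : ℝ) ≤ r := by exact_mod_cast (by omega : (1 : ℤ) ≤ r)
  have hr0 : (0 : ℝ) < r := by linarith
  have hL : 1 ≤ 1 + Real.log r := by have := Real.log_nonneg hr1; linarith
  have hf0 : 0 ≤ (((ρ : ℝ) + 1) / r) ^ 3 := by
    have : (0 : ℝ) ≤ (ρ : ℝ) + 1 := by
      have : (1 : ℝ) ≤ ρ := by exact_mod_cast hρ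
      linarith
    positivity
  by_cases htriv : r ≤ 4 * (ρ + 1)
  · -- trivial pairs
    have hq : (1 / 4 : ℝ) ≤ ((ρ : ℝ) + 1) / r := by
      rw [le_div_iff₀ hr0]
      have : (r : ℝ) ≤ 4 * ((ρ : ℝ) + 1) := by exact_mod_cast htriv
      linarith
    have hq3 : (1 / 4 : ℝ) ^ 3 ≤ (((ρ : ℝ) + 1) / r) ^ 3 := pow_le_pow_left₀ (by norm_num) hq 3
    have hAf : 1 ≤ 64 * (10 : ℝ) ^ 14 * (((ρ : ℝ) + 1) / r) ^ 3 := by nlinarith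
    have h1 : E ≤ 64 * (10 : ℝ) ^ 14 * (((ρ : ℝ) + 1) / r) ^ 3 * E := le_mul_of_one_le_left hE0 hAf
    nlinarith [mul_nonneg hε.le hE0]
  · push Not at htriv
    by_cases hreg : (10 : ℝ) ^ 18 * (1 + Real.log r) ^ 2 ≤ ε' ^ 2 * r
    · have h := oneStep_regimeA u x hρ htriv hu hmin hε'0 hε'1 hreg hthr
      nlinarith [mul_le_mul_of_nonneg_right hε'ε hE0]
    · push Not at hreg
      have hsmall : (r : ℝ) ^ 2 * E ≤ ε' ^ 2 / 10 ^ 7 := regimeB_small hr0 hL hε'0 hreg hthr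
      have h := oneStep_regimeB u x hρ htriv hu hmin hε'0 hε'1 hsmall
      nlinarith [mul_le_mul_of_nonneg_right hε'ε hE0, mul_nonneg hf0 hE0]

/-- ★★★ **`hOneStep_holds` — LEAD ★w1-19936 g9's DISPLAYED [C]-SOCKET `hC` (HOME `ym-ust-19936-w1/g9/DISPLAYED-hC-v1.w1g9.lean.txt`, sha16 2e0c4712bb15d94d,
`def hOneStepText`) TOKEN FOR TOKEN**, `ℝ⁴`-valued unit lattice maps on `ℤ³`: ✓`oneStep_hC` at `V = EuclideanSpace ℝ (Fin 4)`. [folklore] [cite: SchoenUhlenbeck1982, §4] -/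
theorem hOneStep_holds :
    ∃ A : ℝ, 0 ≤ A ∧ ∀ ε : ℝ, 0 < ε → ∃ ε₁ : ℝ, 0 < ε₁ ∧
      ∀ (u : Zd 3 → EuclideanSpace ℝ (Fin 4)) (x : Zd 3) (r : ℤ) (sl : ℝ), 0 ≤ sl →
        (∀ y, ‖u y‖ = 1) →
        (∀ w : Zd 3 → EuclideanSpace ℝ (Fin 4), (∀ y, ‖w y‖ = 1) → (∀ y, y ∉ box x (r - 1) → w y = u y) →
          ∑ y ∈ box x r, ∑ μ : Fin 3, ‖u (y + unitVec μ) - u y‖ ^ 2 ≤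
            (∑ y ∈ box x r, ∑ μ : Fin 3, ‖w (y + unitVec μ) - w y‖ ^ 2) + sl) →
        (∑ y ∈ box x r, ∑ μ : Fin 3, ‖u (y + unitVec μ) - u y‖ ^ 2) * (1 + Real.log r) ^ 6 ≤ ε₁ * r →
        ∀ ρ : ℤ, 1 ≤ ρ → ρ + 1 ≤ r →
          ∑ y ∈ box x ρ, ∑ μ : Fin 3, ‖u (y + unitVec μ) - u y‖ ^ 2 ≤
            (A * (((ρ : ℝ) + 1) / r) ^ 3 + ε) * (∑ y ∈ box x r, ∑ μ : Fin 3, ‖u (y + unitVec μ) - u y‖ ^ 2) + 2 * sl :=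
  oneStep_hC

end Summit.QuantumFields.YangMills.Theorems.PoincareLipschitzSphereMapOneStepHC
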